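import Summits.QuantumFields.YangMills.Theorems.MirrorModularBoostsSoftKernelBoostCovarianceOfInputs
import Summits.QuantumFields.YangMills.Theorems.MirrorModularBoostsSoftKernelBoostCovarianceStepZeroOfLattice
import Summits.QuantumFields.YangMills.Theorems.PencilRigidityNPointIsotropyOfSibling
import Summits.QuantumFields.YangMills.Theorems.PencilRigidityNPointIsotropyCoreCertificate
import HarnessLib

/-!
# `PencilRigidity.NPointIsotropy`: Step 0 from the lattice residual T, and the crux from three existing items
(generation 12 of line `complex-rotation-bandlimit`, crux stmt-QuantumFields-11686; registered stub `stub_stepZeroOfT`)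

Generation 12 of the line transplants the LANDED heat-sandwich operator chain of the sibling crux stmt-QuantumFields-14999
(`MirrorModularBoosts.SoftKernelBoostCovariance`, line `Sketch`): crux 11686 (`PencilRigidity.NPointIsotropy`) reduces to
T (tempered tied lattice approximants of every `𝔖ₙ`, `n ≥ 1` — item stmt-QuantumFields-17721
`IsotropyFromPowerCounting.TemperedCurvatureMoments`) and Σ (the transversely filtered heat-sandwich bound).  This file records
three sorry-free, model-blind pieces of that reduction:

* `stub_stepZeroOfT` (registered signature verbatim) — the pure-logic glue "T ⇒ Step 0 for every family": if every
  `W₁`-family with the eight planar frames and the planar cone admits tempered tied lattice approximants in every degree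
  `n ≥ 1`, then every such family is `NPointRegular` (each `𝔖ₙ|⁰𝒮` is a function).  Proof: 14999's landed pointwise glue
  `SoftKernelBoostCovariance.Sketch.stub_stepZeroOfLattice` at the scheme's spacings `sch.a`, half-sides `sch.L`
  (`a_pos`, `tendsto_a`, `tendsto_L`) and the normalisation `𝔖₀ ≡ 1` read off `W1 = Tie ∧ OSPackage ∧ …`
  (`OSPackage` starts with `IsNormalized`).
* `sandwichBoundRadial_of_items` — `PencilRigidity.CurvatureKernelBound` (stmt-QuantumFields-11687, BY NAME) and Σ in its
  registered item-17720 form (kernel-triple antecedent, `μ < 4` in both frames; quoted as a hypothesis) imply the RADIAL form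
  of Σ asked of this crux's families (the registered `stub_sandwichBoundRadial`: `W1 → EightFrameRP → RadialKernel →
  Σ_e₀(μ < 4) ∧ Σ_45°(any)`), for every compact simple `G` with ANY Borel structure (transported along
  `BorelSpace.measurable_eq`; the cone is the landed `planarCone_of_W1`).
* `nPointIsotropy_of_items` — the crux `PencilRigidity.NPointIsotropy` BY NAME from three existing items: T (quoted),
  Σ in item-17720 form (quoted) and `PencilRigidity.CurvatureKernelBound` (by name), through 14999's landed
  `stub_cruxOfInputs` (T feeds its Step-0 antecedent through `stub_stepZeroOfLattice`) and this crux's landed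
  `nPointIsotropy_of_kernelBound_of_softKernel'`.

The two quoted statement hypotheses are the registered item texts, not imports (Theses files of other routes may lag the
item texts); a proof of each item discharges them verbatim.  Nothing here is specific to Yang–Mills beyond the shape of `W1`.

References: K. Osterwalder, R. Schrader, Comm. Math. Phys. 31 (1973) §2–3 and 42 (1975) §2, Ch. V (`⁰𝒮`, E0, temperedness
of lattice approximants, boost/continuation bookkeeping); J. Glimm, A. Jaffe, Quantum Physics (1987) §9.5–9.6, §19.5–19.7
(lattice approximation, heat-kernel sandwich estimates). [folklore]
-/

noncomputable section

namespace Summit.QuantumFields.YangMills.Theorems.NPointIsotropy.ComplexRotationBandlimit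

open scoped BigOperators SchwartzMap InnerProductSpace
open MeasureTheory Filter Topology
open Literature.MathematicalPhysics.QuantumLattice Literature.MathematicalPhysics.AQFT
  Literature.MathematicalPhysics.QuantumFieldTheory
open Summit.QuantumFields.YangMills.Theorems.NPointIsotropy.Negative (E4 NPointRegular RadialKernel nPointIsotropy_iff)
open Summit.QuantumFields.YangMills.Theorems.CurvatureBoostCovariance.Negative
  (OSPackage Translations Hypercubic EightFrameRP PlanarCone PlanarInvariant Tie Gaps W1)

/-- **STEP 0 FROM T, FOR EVERY FAMILY (registered stub `stub_stepZeroOfT` of crux stmt-QuantumFields-11686, generation 12).**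
If every one-species family `S₁` on `ℝ⁴` tied to a lattice Yang–Mills scheme (`W1 r sch S₁`, any compact simple `G` with any
Borel structure) with reflection positivity in the eight planar frames and the planar spectral cone admits, in every degree
`n ≥ 1`, lattice densities `D_k : (ℤ⁴)ⁿ → ℝ` TEMPERED at injective multi-sites of the box `box 4 (sch.L k)` for `k ≥ k₀`
(`|D_k x| ≤ C (1 + ‖a_k x‖)^N (1 + Σ_i Σ_{j ≠ i} ‖a_k xᵢ - a_k xⱼ‖⁻¹)^N`, `a_k = sch.a k`) and TIED to `S₁ n` (the Riemann sums
`(a_k⁴)ⁿ Σ_{x ∈ boxⁿ} ∏ᵢ fᵢ(a_k xᵢ) D_k x → S₁ n F` for every off-diagonal real product tensor `F = ⊗ᵢ fᵢ`) — the shared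
lattice residual T = item stmt-QuantumFields-17721 — THEN every such family is `NPointRegular` (Step 0: each `𝔖ₙ|⁰𝒮` is
integration against a function).  Pure logic over 14999's landed pointwise glue `stub_stepZeroOfLattice`, instantiated at
`sch.a`, `sch.L` (`sch.a_pos`, `sch.tendsto_a`, `sch.tendsto_L`) with the normalisation `𝔖₀ ≡ 1` from `W1`
(`W1 = Tie ∧ OSPackage ∧ …`, `OSPackage = IsNormalized ∧ …`). -/
theorem stub_stepZeroOfT :
    open Literature.MathematicalPhysics.QuantumLattice Literature.MathematicalPhysics.AQFT
      Literature.MathematicalPhysics.QuantumFieldTheory Literature.Probability.LatticeModels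
      Summit.QuantumFields.YangMills.Theorems.CurvatureBoostCovariance.Negative
      Summit.QuantumFields.YangMills.Theorems.NPointIsotropy.Negative in
    (∀ (G : Type) [Group G] [TopologicalSpace G] [IsTopologicalGroup G] [CompactSpace G]
      [MeasurableSpace G] [BorelSpace G], IsCompactSimpleLieGroup G →
      ∀ (r : LatticeRep G) (sch : SpeciesScheme (YMSpecies G)) (S₁ : SchwingerFamily E4),
        W1 r sch S₁ → EightFrameRP S₁ → PlanarCone S₁ →
        ∀ n : ℕ, 0 < n → ∃ (D : ℕ → (Fin n → Site 4) → ℝ) (C : ℝ) (N k₀ : ℕ), 0 < C ∧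
          (∀ k : ℕ, k₀ ≤ k → ∀ x : Fin n → Site 4, (∀ i, x i ∈ box 4 (sch.L k)) → Function.Injective x →
            |D k x| ≤ C * (1 + ‖fun i => sch.a k • siteToE (x i)‖) ^ N *
              (1 + ∑ i, ∑ j ∈ Finset.univ.erase i,
                ‖sch.a k • siteToE (x i) - sch.a k • siteToE (x j)‖⁻¹) ^ N) ∧
          ∀ (f : Fin n → SchwartzMap E4 ℝ) (F : SchwartzMap (Fin n → E4) ℂ),
            IsTensorOf F (fun i => ofRealTest (f i)) → IsOffDiagonal F →
            Filter.Tendsto (fun k => (((sch.a k ^ 4) ^ n *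
              ∑ x ∈ Fintype.piFinset (fun _ : Fin n => box 4 (sch.L k)),
                (∏ i, f i (sch.a k • siteToE (x i))) * D k x : ℝ) : ℂ)) Filter.atTop (nhds (S₁ n F))) →
    ∀ (G : Type) [Group G] [TopologicalSpace G] [IsTopologicalGroup G] [CompactSpace G]
      [MeasurableSpace G] [BorelSpace G], IsCompactSimpleLieGroup G →
      ∀ (r : LatticeRep G) (sch : SpeciesScheme (YMSpecies G)) (S₁ : SchwingerFamily E4),
        W1 r sch S₁ → EightFrameRP S₁ → PlanarCone S₁ → NPointRegular S₁ := by
  intro hT G _ _ _ _ _ _ hG r sch S₁ hW h8 hC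
  exact Summit.QuantumFields.YangMills.Theorems.SoftKernelBoostCovariance.Sketch.stub_stepZeroOfLattice sch.a sch.L S₁
    sch.a_pos sch.tendsto_a sch.tendsto_L hW.2.1.1 (fun n hn => hT G hG r sch S₁ hW h8 hC n hn)

/-- **Σ_radial FROM THE ITEMS**: `PencilRigidity.CurvatureKernelBound` (stmt-QuantumFields-11687, BY NAME) and the sandwich
bound Σ in its registered 14999 / item-17720 form (kernel-triple antecedent, `μ < 4` in both frames; taken as a hypothesis —
Cruxes files are not importable) imply the conclusion of `stub_sandwichBoundRadial` for every family (the radial-kernel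
antecedent is not even used; the Borel structure is transported along `BorelSpace.measurable_eq`). -/
theorem sandwichBoundRadial_of_items
    (hKB : Summit.QuantumFields.YangMills.Theses.PencilRigidity.CurvatureKernelBound)
    (hSig0 : ∀ (G : Type) [Group G] [TopologicalSpace G] [IsTopologicalGroup G] [CompactSpace G]
       [MeasurableSpace G] [BorelSpace G], IsCompactSimpleLieGroup G →
       ∀ (r : LatticeRep G) (sch : SpeciesScheme (YMSpecies G)) (S₁ : SchwingerFamily E4),
         W1 r sch S₁ → EightFrameRP S₁ → PlanarCone S₁ →
         (∃ (K : E4 → ℝ) (C η : ℝ), 0 < η ∧ ContinuousOn K {x : E4 | x ≠ 0} ∧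
           (∀ x : E4, x ≠ 0 → |K x| ≤ C * (1 + ‖x‖ ^ (η - 10))) ∧
           ∀ F : 𝓢((Fin 2 → E4), ℂ), IsOffDiagonal F →
             MeasureTheory.Integrable (fun x : Fin 2 → E4 => (K (x 0 - x 1) : ℂ) * F x) ∧
               S₁ 2 F = ∫ x : Fin 2 → E4, (K (x 0 - x 1) : ℂ) * F x) →
         (∀ (h : OSReconstructionNoE1 S₁.toLabelled), ∃ μ C : ℝ, μ < 4 ∧
           (∀ (u v : ℝ), 0 < u → 0 < v → u ≤ 1 → v ≤ 1 →
              ∀ (f₁ : 𝓢((Fin 1 → E4), ℂ)) (g hh : ℝ × ℝ → ℂ) (Mg Mh Mh' : ℝ),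
                (∀ x : Fin 1 → E4, f₁ x = g (x 0 0, x 0 1) * hh (x 0 2, x 0 3)) →
                (∀ p : ℝ × ℝ, g p ≠ 0 → u ≤ p.1 ∧ p.1 ≤ 2 * u) →
                MeasureTheory.Integrable g → (∫ p, ‖g p‖) ≤ Mg →
                MeasureTheory.Integrable hh → (∫ p, ‖hh p‖) ≤ Mh → (∀ p, ‖hh p‖ ≤ Mh') →
              ∀ (n : ℕ) (W : 𝓢((Fin n → E4), ℂ)) (hW : IsTimeOrdered W)
                (hFW : IsTimeOrdered
                  (SchwartzMap.appendTensor f₁ (translateMulti ((2 * u + v) • EuclideanSpace.single 0 1) W))),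
                ‖h.fieldVec (1 + n) (fun _ => ())
                    (SchwartzMap.appendTensor f₁ (translateMulti ((2 * u + v) • EuclideanSpace.single 0 1) W)) hFW‖
                  ≤ C * Mg * (Mh + Mh') * (u ^ (-μ) + v ^ (-μ)) * ‖h.fieldVec n (fun _ => ()) W hW‖)) ∧
         (∀ (h' : OSReconstructionNoE1 (SchwingerFamily.toLabelled
             (fun n => (S₁ n).comp (linActMulti (planeRot (0 : Fin 3) (Real.pi / 4)))))),
           ∃ μ C : ℝ, μ < 4 ∧
           (∀ (u v : ℝ), 0 < u → 0 < v → u ≤ 1 → v ≤ 1 →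
              ∀ (f₁ : 𝓢((Fin 1 → E4), ℂ)) (g hh : ℝ × ℝ → ℂ) (Mg Mh Mh' : ℝ),
                (∀ x : Fin 1 → E4, f₁ x = g (x 0 0, x 0 1) * hh (x 0 2, x 0 3)) →
                (∀ p : ℝ × ℝ, g p ≠ 0 → u ≤ p.1 ∧ p.1 ≤ 2 * u) →
                MeasureTheory.Integrable g → (∫ p, ‖g p‖) ≤ Mg →
                MeasureTheory.Integrable hh → (∫ p, ‖hh p‖) ≤ Mh → (∀ p, ‖hh p‖ ≤ Mh') →
              ∀ (n : ℕ) (W : 𝓢((Fin n → E4), ℂ)) (hW : IsTimeOrdered W)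
                (hFW : IsTimeOrdered
                  (SchwartzMap.appendTensor f₁ (translateMulti ((2 * u + v) • EuclideanSpace.single 0 1) W))),
                ‖h'.fieldVec (1 + n) (fun _ => ())
                    (SchwartzMap.appendTensor f₁ (translateMulti ((2 * u + v) • EuclideanSpace.single 0 1) W)) hFW‖
                  ≤ C * Mg * (Mh + Mh') * (u ^ (-μ) + v ^ (-μ)) * ‖h'.fieldVec n (fun _ => ()) W hW‖))) :
    ∀ (G : Type) [Group G] [TopologicalSpace G] [IsTopologicalGroup G] [CompactSpace G]
      [MeasurableSpace G] [BorelSpace G], IsCompactSimpleLieGroup G →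
      ∀ (r : LatticeRep G) (sch : SpeciesScheme (YMSpecies G)) (S₁ : SchwingerFamily E4),
        W1 r sch S₁ → EightFrameRP S₁ → RadialKernel S₁ →
        (∀ (h : OSReconstructionNoE1 S₁.toLabelled), ∃ μ C : ℝ, μ < 4 ∧
          (∀ (u v : ℝ), 0 < u → 0 < v → u ≤ 1 → v ≤ 1 →
             ∀ (f₁ : 𝓢((Fin 1 → E4), ℂ)) (g hh : ℝ × ℝ → ℂ) (Mg Mh Mh' : ℝ),
               (∀ x : Fin 1 → E4, f₁ x = g (x 0 0, x 0 1) * hh (x 0 2, x 0 3)) →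
               (∀ p : ℝ × ℝ, g p ≠ 0 → u ≤ p.1 ∧ p.1 ≤ 2 * u) →
               MeasureTheory.Integrable g → (∫ p, ‖g p‖) ≤ Mg →
               MeasureTheory.Integrable hh → (∫ p, ‖hh p‖) ≤ Mh → (∀ p, ‖hh p‖ ≤ Mh') →
             ∀ (n : ℕ) (W : 𝓢((Fin n → E4), ℂ)) (hW : IsTimeOrdered W)
               (hFW : IsTimeOrdered
                 (SchwartzMap.appendTensor f₁ (translateMulti ((2 * u + v) • EuclideanSpace.single 0 1) W))),
               ‖h.fieldVec (1 + n) (fun _ => ())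
                   (SchwartzMap.appendTensor f₁ (translateMulti ((2 * u + v) • EuclideanSpace.single 0 1) W)) hFW‖
                 ≤ C * Mg * (Mh + Mh') * (u ^ (-μ) + v ^ (-μ)) * ‖h.fieldVec n (fun _ => ()) W hW‖)) ∧
        (∀ (h' : OSReconstructionNoE1 (SchwingerFamily.toLabelled
            (fun n => (S₁ n).comp (linActMulti (planeRot (0 : Fin 3) (Real.pi / 4)))))),
          ∃ μ C : ℝ,
          (∀ (u v : ℝ), 0 < u → 0 < v → u ≤ 1 → v ≤ 1 →
             ∀ (f₁ : 𝓢((Fin 1 → E4), ℂ)) (g hh : ℝ × ℝ → ℂ) (Mg Mh Mh' : ℝ),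
               (∀ x : Fin 1 → E4, f₁ x = g (x 0 0, x 0 1) * hh (x 0 2, x 0 3)) →
               (∀ p : ℝ × ℝ, g p ≠ 0 → u ≤ p.1 ∧ p.1 ≤ 2 * u) →
               MeasureTheory.Integrable g → (∫ p, ‖g p‖) ≤ Mg →
               MeasureTheory.Integrable hh → (∫ p, ‖hh p‖) ≤ Mh → (∀ p, ‖hh p‖ ≤ Mh') →
             ∀ (n : ℕ) (W : 𝓢((Fin n → E4), ℂ)) (hW : IsTimeOrdered W)
               (hFW : IsTimeOrdered
                 (SchwartzMap.appendTensor f₁ (translateMulti ((2 * u + v) • EuclideanSpace.single 0 1) W))),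
               ‖h'.fieldVec (1 + n) (fun _ => ())
                   (SchwartzMap.appendTensor f₁ (translateMulti ((2 * u + v) • EuclideanSpace.single 0 1) W)) hFW‖
                 ≤ C * Mg * (Mh + Mh') * (u ^ (-μ) + v ^ (-μ)) * ‖h'.fieldVec n (fun _ => ()) W hW‖)) := by
  intro G _ _ _ _ inst hB hG r sch S₁ hW h8 _
  have hmeas : inst = borel G := hB.measurable_eq
  subst hmeas
  letI : MeasurableSpace G := borel G
  haveI : BorelSpace G := ⟨rfl⟩
  have hC : PlanarCone S₁ := planarCone_of_W1 hW h8
  have hK := hKB G hG r sch S₁ hW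
  obtain ⟨hSig, hSigT⟩ := hSig0 G hG r sch S₁ hW h8 hC hK
  exact ⟨hSig, fun h' => let ⟨μ, C, _, hS⟩ := hSigT h'; ⟨μ, C, hS⟩⟩

/-- **THE CRUX FROM THREE EXISTING ITEMS** — T (stmt-QuantumFields-17721 `IsotropyFromPowerCounting.TemperedCurvatureMoments`, the
registered text of `stub_temperedLatticeApproximants`), Σ (stmt-QuantumFields-17720 `IsotropyFromPowerCounting.CurvatureSandwichBound`,
the registered text of 14999's `stub_sandwichBound`) and `PencilRigidity.CurvatureKernelBound` (stmt-QuantumFields-11687, BY NAME)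
imply `PencilRigidity.NPointIsotropy` — pure logic over 14999's landed `stub_cruxOfInputs` (T feeds its Step-0 antecedent through
`stub_stepZeroOfLattice`) and this crux's landed `nPointIsotropy_of_kernelBound_of_softKernel'`.  The two statement hypotheses
are quoted, not imported (Theses files of other routes may lag the item texts); a proof of each item discharges them verbatim. -/
theorem nPointIsotropy_of_items
    (hT : ∀ (G : Type) [Group G] [TopologicalSpace G] [IsTopologicalGroup G] [CompactSpace G]
      [MeasurableSpace G] [BorelSpace G], IsCompactSimpleLieGroup G →
      ∀ (r : LatticeRep G) (sch : SpeciesScheme (YMSpecies G)) (S₁ : SchwingerFamily E4),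
        W1 r sch S₁ → EightFrameRP S₁ → PlanarCone S₁ →
        ∀ n : ℕ, 0 < n → ∃ (D : ℕ → (Fin n → Literature.Probability.LatticeModels.Site 4) → ℝ) (C : ℝ) (N k₀ : ℕ),
          0 < C ∧
          (∀ k : ℕ, k₀ ≤ k → ∀ x : Fin n → Literature.Probability.LatticeModels.Site 4,
            (∀ i, x i ∈ Literature.Probability.LatticeModels.box 4 (sch.L k)) → Function.Injective x →
            |D k x| ≤ C * (1 + ‖fun i => sch.a k • siteToE (x i)‖) ^ N *
              (1 + ∑ i, ∑ j ∈ Finset.univ.erase i,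
                ‖sch.a k • siteToE (x i) - sch.a k • siteToE (x j)‖⁻¹) ^ N) ∧
          ∀ (f : Fin n → 𝓢(E4, ℝ)) (F : 𝓢((Fin n → E4), ℂ)),
            IsTensorOf F (fun i => ofRealTest (f i)) → IsOffDiagonal F →
            Filter.Tendsto (fun k => (((sch.a k ^ 4) ^ n *
              ∑ x ∈ Fintype.piFinset (fun _ : Fin n => Literature.Probability.LatticeModels.box 4 (sch.L k)),
                (∏ i, f i (sch.a k • siteToE (x i))) * D k x : ℝ) : ℂ)) Filter.atTop (nhds (S₁ n F)))
    (hSig0 : ∀ (G : Type) [Group G] [TopologicalSpace G] [IsTopologicalGroup G] [CompactSpace G]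
       [MeasurableSpace G] [BorelSpace G], IsCompactSimpleLieGroup G →
       ∀ (r : LatticeRep G) (sch : SpeciesScheme (YMSpecies G)) (S₁ : SchwingerFamily E4),
         W1 r sch S₁ → EightFrameRP S₁ → PlanarCone S₁ →
         (∃ (K : E4 → ℝ) (C η : ℝ), 0 < η ∧ ContinuousOn K {x : E4 | x ≠ 0} ∧
           (∀ x : E4, x ≠ 0 → |K x| ≤ C * (1 + ‖x‖ ^ (η - 10))) ∧
           ∀ F : 𝓢((Fin 2 → E4), ℂ), IsOffDiagonal F →
             MeasureTheory.Integrable (fun x : Fin 2 → E4 => (K (x 0 - x 1) : ℂ) * F x) ∧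
               S₁ 2 F = ∫ x : Fin 2 → E4, (K (x 0 - x 1) : ℂ) * F x) →
         (∀ (h : OSReconstructionNoE1 S₁.toLabelled), ∃ μ C : ℝ, μ < 4 ∧
           (∀ (u v : ℝ), 0 < u → 0 < v → u ≤ 1 → v ≤ 1 →
              ∀ (f₁ : 𝓢((Fin 1 → E4), ℂ)) (g hh : ℝ × ℝ → ℂ) (Mg Mh Mh' : ℝ),
                (∀ x : Fin 1 → E4, f₁ x = g (x 0 0, x 0 1) * hh (x 0 2, x 0 3)) →
                (∀ p : ℝ × ℝ, g p ≠ 0 → u ≤ p.1 ∧ p.1 ≤ 2 * u) →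
                MeasureTheory.Integrable g → (∫ p, ‖g p‖) ≤ Mg →
                MeasureTheory.Integrable hh → (∫ p, ‖hh p‖) ≤ Mh → (∀ p, ‖hh p‖ ≤ Mh') →
              ∀ (n : ℕ) (W : 𝓢((Fin n → E4), ℂ)) (hW : IsTimeOrdered W)
                (hFW : IsTimeOrdered
                  (SchwartzMap.appendTensor f₁ (translateMulti ((2 * u + v) • EuclideanSpace.single 0 1) W))),
                ‖h.fieldVec (1 + n) (fun _ => ())
                    (SchwartzMap.appendTensor f₁ (translateMulti ((2 * u + v) • EuclideanSpace.single 0 1) W)) hFW‖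
                  ≤ C * Mg * (Mh + Mh') * (u ^ (-μ) + v ^ (-μ)) * ‖h.fieldVec n (fun _ => ()) W hW‖)) ∧
         (∀ (h' : OSReconstructionNoE1 (SchwingerFamily.toLabelled
             (fun n => (S₁ n).comp (linActMulti (planeRot (0 : Fin 3) (Real.pi / 4)))))),
           ∃ μ C : ℝ, μ < 4 ∧
           (∀ (u v : ℝ), 0 < u → 0 < v → u ≤ 1 → v ≤ 1 →
              ∀ (f₁ : 𝓢((Fin 1 → E4), ℂ)) (g hh : ℝ × ℝ → ℂ) (Mg Mh Mh' : ℝ),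
                (∀ x : Fin 1 → E4, f₁ x = g (x 0 0, x 0 1) * hh (x 0 2, x 0 3)) →
                (∀ p : ℝ × ℝ, g p ≠ 0 → u ≤ p.1 ∧ p.1 ≤ 2 * u) →
                MeasureTheory.Integrable g → (∫ p, ‖g p‖) ≤ Mg →
                MeasureTheory.Integrable hh → (∫ p, ‖hh p‖) ≤ Mh → (∀ p, ‖hh p‖ ≤ Mh') →
              ∀ (n : ℕ) (W : 𝓢((Fin n → E4), ℂ)) (hW : IsTimeOrdered W)
                (hFW : IsTimeOrdered
                  (SchwartzMap.appendTensor f₁ (translateMulti ((2 * u + v) • EuclideanSpace.single 0 1) W))),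
                ‖h'.fieldVec (1 + n) (fun _ => ())
                    (SchwartzMap.appendTensor f₁ (translateMulti ((2 * u + v) • EuclideanSpace.single 0 1) W)) hFW‖
                  ≤ C * Mg * (Mh + Mh') * (u ^ (-μ) + v ^ (-μ)) * ‖h'.fieldVec n (fun _ => ()) W hW‖)))
    (hKB : Summit.QuantumFields.YangMills.Theses.PencilRigidity.CurvatureKernelBound) :
    Summit.QuantumFields.YangMills.Theses.PencilRigidity.NPointIsotropy :=
  Summit.QuantumFields.YangMills.Theorems.NPointIsotropy.ComplexRotationBandlimit.nPointIsotropy_of_kernelBound_of_softKernel'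
    hKB
    (Summit.QuantumFields.YangMills.Theorems.SoftKernelBoostCovariance.Sketch.stub_cruxOfInputs
      (fun G _ _ _ _ _ _ hG r sch S₁ hW h8 hC =>
        Summit.QuantumFields.YangMills.Theorems.SoftKernelBoostCovariance.Sketch.stub_stepZeroOfLattice
          sch.a sch.L S₁ sch.a_pos sch.tendsto_a sch.tendsto_L hW.2.1.1 (fun n hn => hT G hG r sch S₁ hW h8 hC n hn))
      hSig0)

end Summit.QuantumFields.YangMills.Theorems.NPointIsotropy.ComplexRotationBandlimit

end
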